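import Mathlib.Geometry.Manifold.PoincareConjecture
import Literature.Topology.FourManifolds.PropertyRStrict
import Literature.Topology.FourManifolds.RLinkSphere
import Literature.Topology.FourManifolds.ThetaFour
import HarnessLib
import HarnessLib.Audit
import HarnessLib.Audit.TribunalTags

/-!
# Strong-Hypothesis Library — summit `SmoothPoincare4` (D-0034, skeleton)

The REGISTRY of known strong hypotheses `H` (open conjectures with `H ⇒ P` landed or printed) and of
known EQUIVALENT REFORMULATIONS `E` (`E ↔ P` landed or printed) for the single-problem summit
`SmoothPoincare4`. Tag key `"SmoothPoincare4.SmoothPoincare4"`. The kernel tribunal (`#h21_tribunal`,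
D-0033 T1 rule (a)) probes every registered `H` against a route crux `C` for `H → C`; the bridges
live summit-side in `Summits/SmoothPoincare4/StrongHypotheses.lean`.

## The problem

* `SmoothPoincare4` (root decl, `Summits/SmoothPoincare4/SmoothPoincare4/Statement.lean`,
  `:= Literature.SPC4.SmoothPoincareConjectureFour.{0}`, `[problem: spc4]`): for every Hausdorff
  second-countable `M : Type` and every `C^∞` atlas on `M` modelled on `ℝ⁴`, a homotopy equivalence
  `M ≃ₕ S⁴` yields a diffeomorphism `M ≃ₘ⟮𝓡 4, 𝓡 4⟯ S⁴` — Mathlib's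
  `ContinuousMap.HomotopyEquiv.NonemptyDiffeomorphSphere M 4` closed over all such `M`
  (Kirby 1997, Problem 4.89: "A smooth homotopy 4-sphere `Σ` is diffeomorphic to `S⁴`").

## Census (skeleton; 2026-08-17)

Peculiarity of this summit: essentially every famous open statement in its neighbourhood is a
CONSEQUENCE of `P` (a special family of homotopy 4-spheres being standard), a strengthening of `P` on
a SUB-FAMILY only, or a sibling uniqueness question — none is known to imply `P`. The registry is
therefore short: one folklore equivalent criterion and one printed strictly-stronger package, both
NEW closed `Prop`s over existing tree vocabulary (`IsHCobordant`, `IsRLinkSphere`,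
`StrictGeneralizedPropertyRConjecture`). `FM` = `Literature.Topology.FourManifolds`;
`Ba` = `Literature.Barriers.SmoothPoincare4`; `Th` = `Summit.SmoothPoincare4.SmoothPoincare4.Theses`.

| # | `H` / `E` | one-line statement | relation to `P` | source | status here | bridge |
|---|---|---|---|---|---|---|
| 1 | `HCobordantSphereFourStandard` (the smooth 5-dimensional h-cobordism conjecture AT `S⁴`) | every closed smooth 4-manifold smoothly h-cobordant to `S⁴` is diffeomorphic to `S⁴` | EQUIVALENT: `E ⇒ P` because every homotopy 4-sphere is h-cobordant to `S⁴` (`Θ₄ = 0`, Kervaire–Milnor 1963 / Wall 1964; tree fact `FM.isHCobordant_sphere_of_homotopySphere_four`); `P ⇒ E` because the ends of an h-cobordism are homotopy equivalent | folklore; the `N = S⁴` instance of the (false in general, Donaldson 1987) "h-cobordism conjecture for smooth 4-manifolds" `Ba.HCobordismPrincipleFour` | `registered` — NEW decl (this file) | printed: `Summit.SmoothPoincare4.StrongHypotheses.HCobordantSphereFourStandardImpliesSmoothPoincare4` |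
| 2 | `NoOneHandlesAndStrictGPR` | every smooth homotopy 4-sphere admits a handle decomposition without 1-handles (is an R-link sphere `FM.IsRLinkSphere X L`) AND the generalised Property R conjecture in its printed (strict handle-slide) form `FM.StrictGeneralizedPropertyRConjecture` | AT LEAST AS STRONG, presumably strictly: `P ⇒` first conjunct (take `L = ∅`), `P ⇒ GPRC` unknown; `H ⇒ P` printed: an R-link sphere `Σ_L` with `L` handle-slide equivalent to the `0`-framed unlink is `S⁴` (Kirby 1997 Problem 1.82 remarks; Gompf–Scharlemann–Thompson 2010 §9 and Prop. 9.2, "SPC4 for homotopy spheres that admit handle decompositions without 1-handles") | Kirby 1997 Problems 1.82, 4.18, 4.89; GST 2010 §2 Conj. 1, §9 Prop. 9.2 | `registered` — NEW decl (this file); CAVEAT: GST "conclude that [GPRC] is probably false" (§1) — their WEAK GPRC (§9 Conj. 4), which by Prop. 9.2 would make the package EQUIVALENT to `P`, is not formalised in the tree (missing notion: stabilisation of a framed link by a distant `0`-framed unlink with cancelling pairs) | printed: `Summit.SmoothPoincare4.StrongHypotheses.NoOneHandlesAndStrictGPRImpliesSmoothPoincare4` |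
| 3 | smooth Schoenflies conjecture `FM.SmoothSchoenfliesConjectureFour` (equator form; ball form `smoothSchoenfliesConjectureFour_iff_ballForm`; summit copy `Summit.SmoothPoincare4.SmoothPoincare4.SmoothSchoenfliesConjectureFour`; route conjunct `Th.SchoenfliesSplit`/(B), `Th.EuclideanOrigami.Schoenflies`) | every smoothly embedded `S³ ⊂ S⁴` is standard | CONSEQUENCE of `P` (folklore: the closed complementary pieces are homotopy balls whose caps are homotopy spheres; direction `P ⇒ Schoenflies`, NOT the converse) | Kirby 1997 Problem 4.32 | deliberately NOT registered (wrong direction) | — |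
| 4 | Gluck twist conjecture `FM.GluckTwistConjecture` | every Gluck twist `Σ_K` of `S⁴` along a 2-knot is diffeomorphic to `S⁴` | CONSEQUENCE of `P` (landed `FM.GluckTwistConjecture.of_nonemptyDiffeomorphSphere`, given the Gluck–Freedman homeomorphism fact) | Gluck 1962 §17; Kirby 1997 Problem 4.24 | deliberately NOT registered (wrong direction) | — |
| 5 | Cappell–Shaneson spheres standard `FM.CappellShanesonSpheresStandard` (`FM.GompfConjectureForTrace n`, parametrised) | the Cappell–Shaneson homotopy spheres `Σ_A` are `S⁴` | CONSEQUENCE of `P` (special family; large parts are theorems: Akbulut–Kirby 1985, Gompf 1991/2010, Akbulut 2010, Kim–Yamada 2023 — barrier `Ba.CappellShanesonFamilyBarrier`) | Cappell–Shaneson 1976; Gompf 2010 | deliberately NOT registered (wrong direction) | — |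
| 6 | generalised Property R alone (`FM.GeneralizedPropertyRConjecture`, `FM.StrictGeneralizedPropertyRConjecture`, `FM.PropertyTwoRConjecture`, `FM.StrictPropertyTwoRConjecture`; all carry the instance binders `[SphereEmbedding.SmoothnessFacts] [Knot.TubularNbhd.SmoothnessFacts]`) | R-links slide to unlinks | STRONGER FOR A SUB-FAMILY ONLY (`⇒ P` for R-link spheres = homotopy spheres without 1-handles, GST Prop. 9.2); packaged with "no 1-handles" in row 2 | Kirby 1997 Problem 1.82; GST 2010 | NOT registered alone (no `H ⇒ P`) | — |
| 7 | Andrews–Curtis conjecture `FM.AndrewsCurtisConjecture` | balanced presentations of the trivial group are AC-trivial | STRONGER FOR A SUB-FAMILY ONLY (AC-triviality of `P` makes the 5-dimensional thickening a ball, so the homotopy spheres built from `P` are standard); conversely AC-NONtriviality of the Akbulut–Kirby presentations would OBSTRUCT strict Property 2R for the GST links (`Ba.PropertyTwoRAndrewsCurtis`, conditional on `Ba.AKPresentationsACNontrivial`) | Andrews–Curtis 1965; Akbulut–Kirby 1985; GST 2010 §7 | NOT registered (no `H ⇒ P`) | — |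
| 8 | slice–ribbon conjecture `FM.SliceRibbonConjecture` | every smoothly slice knot is ribbon | INCOMPARABLE: no implication either way in print; GST 2010 (title, §1) and `Ba.FGMWRasmussenStrategy` / `Ba.MMSW2023Question911Knot` relate potential SPC4 counterexamples to knots slice in homotopy balls but not (visibly) in `B⁴` | Fox 1962; GST 2010; FGMW 2010 | NOT registered | — |
| 9 | one-stabilisation statements ("`Σ # S²×S² ≅ S²×S²` for every homotopy 4-sphere"; route cruxes `Th.….StabOneSuffices`, `Th.….InvertibleOfOneStab`) | one `S² × S²` summand dissolves every homotopy 4-sphere | CONSEQUENCE of `P`; the contractible-piece analogue "one stabilisation suffices" is REFUTED (Kang 2022: `Ba.OneStabilisationBarrier`, `Ba.kang2022_corollary12` against `Ba.OneStabilisationSufficesContractible`) | Wall 1964; Kang 2022 | NOT registered (wrong direction; route forms are Theses decls) | — |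
| 10 | cork-twist / twisted-double reformulations | every cork twist of `S⁴` is `S⁴`; every homotopy 4-sphere is a twisted sphere `D⁴ ∪_φ D⁴` | EQUIVALENT reformulations in print (cork theorem for the h-cobordism `S⁴ ∼ Σ`, Curtis–Freedman–Hsiang–Stong 1996 / Matveyev 1996, over `Θ₄ = 0`; twisted spheres are standard by Cerf's `Γ₄ = 0`, `Ba.TwistedSphereBarrierFour`) | CFHS 1996; Matveyev 1996; Cerf 1968 | `candidate (not yet in tree)` as closed statements — the cork vocabulary of `Ba.ExoticContractible*` is per-pair; not spent in this skeleton | none |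

Not hypotheses for `P` (recorded to prevent mis-registration): the NEGATION flag
`FM.ExistsExoticFourSphere` (`↔ ¬P` given Freedman, landed
`FM.existsExoticFourSphere_iff_not_forall_nonemptyDiffeomorphSphere_four`); the sibling uniqueness /
geography conjectures `FM.NoExoticComplexProjectivePlaneConjecture`, `FM.NoExoticSphereTwoProdConjecture`,
`FM.ElevenEighthsConjecture` (incomparable with `P`); the summit-side symplectic-geography inputs
`Summit.SmoothPoincare4.SmoothPoincare4.Theorems.GompfEulerCharacteristicQuestion` /
`….LiSymplecticBMYConjecture` (they feed the route crux `Th.SymplecticOrigami.NoGenusTwoDoor`, not `P`);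
and the many landed `X ↔ _root_.SmoothPoincare4` with `X` a ROUTE decl (`Th.SblfDescent.SblfExists`,
`Th.SullivanDual.Target` given `GromovChartForm`, `Th.ConvexBisection.PlanarAcyclicBisectionExists`,
`Th.SubcylindricalSplitting.SubcylindricalExistence`, …) — tagging Theses decls would make the tribunal
circular.

## Design of the two new statements

* Both are stated on UNBUNDLED manifolds `M : Type` with Mathlib instances, exactly like the summit
  statement, and against Mathlib's round `S⁴ = Metric.sphere 0 1 ⊆ EuclideanSpace ℝ (Fin 5)` with its
  stereographic `C^∞` structure (the carrier used by `FM.isHCobordant_sphere_of_homotopySphere_four`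
  and by `FM.GluckTwistConjecture`). `IsHCobordant 4 M S⁴` is the tree's UNORIENTED smooth
  h-cobordism relation (`FM/Cobordism`); for simply connected ends it agrees with the oriented one.
* `NoOneHandlesAndStrictGPR` quantifies the printed GPRC over its two `Prop`-valued smoothness-fact
  classes (`∀ [SphereEmbedding.SmoothnessFacts] [Knot.TubularNbhd.SmoothnessFacts], …`, the exact
  binders of `FM.StrictGeneralizedPropertyRConjecture`), the honest closure of an instance-parametrised
  statement; the STRICT form is used because only genuine handle slides leave the R-link sphere
  unchanged (erratum of `FM/KirbyMoves`: the permissive `IsHandleSlideEquivalent` does not).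

## References

[KirbyProblems1997] Problems 1.82, 4.18, 4.24, 4.32, 4.89; [GompfScharlemannThompson2010] §1, §2 Conj. 1,
§7, §9 Prop. 9.2 and Conj. 4; [KervaireMilnorAnnals1963] table p. 504 (`Θ₄ = 0`); [WallJLMS1964] Thms. 2–3;
[DonaldsonIrrationality1987] p. 142; [MilnorHCobordism1965] Thm. 9.1; [FreedmanGompfMorrisonWalker2010] §1;
[Kang2022OneStabilization]; [AkbulutKirby1985]; [GluckTAMS1962] §17.
-/

noncomputable section

open scoped Manifold ContDiff
open ContinuousMap

namespace Literature.StrongHypotheses.SmoothPoincare4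

open Literature.Topology.FourManifolds

/-- Local notation: `𝔼 n` is the model Euclidean space `EuclideanSpace ℝ (Fin n)`. -/
local notation "𝔼 " n:arg => EuclideanSpace ℝ (Fin n)

/-- Local notation: `𝕊 n` is the unit sphere in `EuclideanSpace ℝ (Fin (n + 1))`. -/
local notation "𝕊 " n:arg => (Metric.sphere (0 : EuclideanSpace ℝ (Fin (n + 1))) 1)

/-- OPEN CONJECTURE — the **smooth h-cobordism conjecture at `S⁴`**: every closed smooth 4-manifold
`M` (Hausdorff, second countable, compact, `C^∞` on `ℝ⁴`, in `Type`) which is smoothly h-cobordant to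
the round `S⁴` (`Literature.Topology.FourManifolds.IsHCobordant 4 M S⁴`: some compact smooth 5-manifold
`W` with `∂W = M ⊔ S⁴` and both inclusions homotopy equivalences) is diffeomorphic to `S⁴`. This is the
`N = S⁴` instance of the "h-cobordism conjecture for smooth 4-manifolds" (Donaldson 1987, p. 142; false
in general — barrier `Literature.Barriers.SmoothPoincare4.HCobordismPrincipleFour` /
`HCobordismBarrierFour`), and it is EQUIVALENT to the smooth 4-dimensional Poincaré conjecture: every
homotopy 4-sphere is h-cobordant to `S⁴` (`Θ₄ = 0`, Kervaire–Milnor 1963, tree fact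
`isHCobordant_sphere_of_homotopySphere_four`), and conversely an end of an h-cobordism to `S⁴` is
homotopy equivalent to `S⁴`. Open exactly as SPC4 (bridge PRINTED, summit file). Folklore
reformulation; no single source states it as a named conjecture. [folklore] [status: open] -/
@[conjecture, strong_hypothesis "SmoothPoincare4.SmoothPoincare4"]
def HCobordantSphereFourStandard : Prop :=
  ∀ (M : Type) [TopologicalSpace M] [T2Space M] [SecondCountableTopology M]
    [ChartedSpace (𝔼 4) M] [IsManifold (𝓡 4) ∞ M] [CompactSpace M],
    IsHCobordant 4 M (𝕊 4) → Nonempty (M ≃ₘ⟮𝓡 4, 𝓡 4⟯ (𝕊 4))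

/-- OPEN CONJECTURE — the **"no 1-handles + generalised Property R" package**: (i) every smooth
homotopy 4-sphere `X` (Hausdorff, second countable, `C^∞` on `ℝ⁴`, `X ≃ₕ S⁴`) admits a handle
decomposition WITHOUT 1-handles, i.e. is an R-link sphere `Σ_L = (D⁴ ∪_L 2-handles) ∪ ♮ⁿ S¹ × B³` for
some `n`-component framed link `L` (`Literature.Topology.FourManifolds.IsRLinkSphere X L`; the
homotopy-sphere case of Kirby 1997 Problem 4.18 "Does every [closed simply connected] 4-manifold have a
handlebody decomposition without 1-handles?"), AND (ii) the generalised Property R conjecture in its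
printed handle-slide form (Kirby 1997 Problem 1.82; Gompf–Scharlemann–Thompson 2010 §2 Conjecture 1),
`Literature.Topology.FourManifolds.StrictGeneralizedPropertyRConjecture`, closed over its two
smoothness-fact instance classes. Printed to IMPLY SPC4: for an R-link `L` handle-slide equivalent to
the `0`-framed unlink, `Σ_L ≅ Σ_unlink = S⁴` (GST 2010 §9 and Prop. 9.2, "SPC4 for homotopy spheres
that admit handle decompositions without 1-handles"; Kirby 1997 remarks to Problem 1.82) — bridge
PRINTED, summit file. At least as strong as SPC4 ((i) follows from SPC4 with `L = ∅`); presumably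
strictly stronger, and possibly FALSE: GST §1 "conclude that the conjecture [GPRC] is probably false"
(their weak form, §9 Conjecture 4, is not in the tree). [cite: GompfScharlemannThompson2010, §2 Conjecture 1 and §9 Prop. 9.2] [status: open] -/
@[conjecture, strong_hypothesis "SmoothPoincare4.SmoothPoincare4"]
def NoOneHandlesAndStrictGPR : Prop :=
  (∀ (X : Type) [TopologicalSpace X] [T2Space X] [SecondCountableTopology X]
      [ChartedSpace (𝔼 4) X] [IsManifold (𝓡 4) ∞ X],
      X ≃ₕ (𝕊 4) → ∃ (n : ℕ) (L : FramedLink (Fin n)), IsRLinkSphere X L) ∧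
  ∀ [SphereEmbedding.SmoothnessFacts] [Knot.TubularNbhd.SmoothnessFacts],
    StrictGeneralizedPropertyRConjecture

end Literature.StrongHypotheses.SmoothPoincare4

end
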